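import Literature.AlgebraicGeometry.Morphisms.StalkOfDualNumberRigid
import Mathlib.AlgebraicGeometry.Morphisms.FormallyUnramified
import Mathlib.RingTheory.LocalRing.Module
import HarnessLib

/-!
# A morphism locally of finite type with no non-constant `K[ε]`-points in its fibres is formally unramified — at ALL points
# (Görtz–Wedhorn I (6.4), Prop. 6.7: relative tangent vectors as `K[ε]`-points; EGA IV₄ 17.4.1; Nakayama)

Layer `Literature/AlgebraicGeometry/Morphisms`, namespace `Literature.AlgebraicGeometry.Morphisms`.  THEOREMS ONLY (no definition,
no named fact, no instance, no notation, no `sorry`).  Generic, consumer-agnostic leaf (Mathlib + ★ `StalkOfDualNumberRigid` §1 only);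
in the cell `hodgecm-mathlib` (D-0151) it is brick **W2 + BRIDGE** of the (Mc) grandchild line `F3DualAbelianSchemeMc` (stub N3d′ «the
seesaw graph `Γ → T′` is formally unramified», [MumfordAV1970] §13 pp. 127–129): B-p07 (g20)'s first-order rigidity of the Poincaré family
delivers the hypothesis for EVERY field `K`, this file turns it into `FormallyUnramified`.  Compare ★ `Morphisms.stalk_of_dualNumber_rigid`
(closed points of `ℂ`-schemes, augmented local `ℂ`-algebras) + ★ `formallyUnramified_of_forall_isClosed_map_maximalIdeal` (Jacobson source):
here NO Jacobson hypothesis, NO algebraic closure, ALL points — the base may be a DVR (port decision D2 of the (Mc) spine).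

* §1 `FormallyUnramified.of_forall_stalkMap` — **W2**: `f` is formally unramified as soon as all its stalk maps are (Mathlib
  `HasRingHomProperty.of_stalkMap` + `RingHom.FormallyUnramified.ofLocalizationPrime`; all points, one line).
* §2 `Algebra.FormallyUnramified.of_forall_derivation_eq_zero` — commutative algebra: for `A → B` essentially of finite type with `B`
  local, if every `A`-derivation `B → κ(B)` vanishes then `Ω[B⁄A] = 0` (`Hom_B(Ω[B⁄A], κ) = Der_A(B, κ)`, Mathlib
  `KaehlerDifferential.linearMapEquivDerivation`; `κ ⊗_B Ω = 0` because its dual is `0`; Nakayama, Mathlib `IsLocalRing.subsingleton_tensorProduct`).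
* §3 the `κ[ε]`-point of a derivation: `isLocalHom_algebraMap_dualNumber'`, `exists_ringHom_dualNumber_of_derivation` (the local ring map
  `b ↦ b̄ + (D b) ε : B → κ[ε]`, [GortzWedhorn2020] Prop. 6.7).
* §4 **`FormallyUnramified.of_dualNumber_rigid`** — for `p : X ⟶ Y` locally of finite type: if for every field `K` every `K[ε]`-point
  `γ` of `X` whose image in `Y` is CONSTANT (`γ ≫ p = Spec(K[ε] ← K) ≫ t`) is itself constant, then `p` is formally unramified.  At
  `x ∈ X` an `𝒪_{Y,p x}`-derivation `D : 𝒪_{X,x} → κ(x)` is the `κ(x)[ε]`-point `b ↦ b̄ + (D b)ε` through `x` over the constant point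
  `Spec κ(x)[ε] → Spec κ(x) → Y`, hence constant by hypothesis (with `K := κ(x)`), i.e. `D = 0` (read through ★ §1's dictionary
  «points with values in a local ring through `x` ↔ local homomorphisms `𝒪_{X,x} → R`»); so §2 applies at every stalk and §1 concludes.

HC_CM is proved only modulo the 7 printed citations until rung 0 closes; nothing here is about HC.

## References
* [GortzWedhorn2020] U. Görtz, T. Wedhorn, *Algebraic Geometry I* (2nd ed. 2020), (6.4) Prop. 6.7 (tangent vectors as `k[ε]`-points).
* [EGAIV4] A. Grothendieck, J. Dieudonné, *EGA IV₄* (1967), Prop. 17.4.1, Cor. 17.4.2 (unramified ⇔ `Ω = 0`, pointwise).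
* [StacksProject] The Stacks Project, Tags 00UO (formally unramified ⇔ `Ω = 0`), 02G3/039H (pointwise), 00DV (Nakayama).
* [MumfordAV1970] D. Mumford, *Abelian Varieties* (1970), §13 (proof of the theorem, pp. 125–130) — the consumer.
-/

set_option autoImplicit false

noncomputable section

universe u

open CategoryTheory CategoryTheory.Limits AlgebraicGeometry TopologicalSpace IsLocalRing TensorProduct

namespace Literature.AlgebraicGeometry.Morphisms

/-! ### §1 W2: formally unramified from the stalk maps at ALL points -/

/-- **W2.  A morphism of schemes all of whose stalk maps `𝒪_{Y,f x} → 𝒪_{X,x}` are formally unramified is formally unramified** (no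
Jacobson hypothesis, all points): formal unramifiedness of ring maps is checked at primes (Mathlib `RingHom.FormallyUnramified.ofLocalizationPrime`,
`HasRingHomProperty.of_stalkMap`). [cite: EGAIV4, Prop. 17.4.1] [cite: StacksProject, Tag 02G3] -/
theorem FormallyUnramified.of_forall_stalkMap {X Y : Scheme.{u}} (f : X ⟶ Y)
    (h : ∀ x : X, (f.stalkMap x).hom.FormallyUnramified) : FormallyUnramified f :=
  HasRingHomProperty.of_stalkMap RingHom.FormallyUnramified.ofLocalizationPrime h

/-! ### §2 Commutative algebra: no `A`-derivations into the residue field ⇒ `Ω[B⁄A] = 0` -/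

section Algebra

variable {A B : Type u} [CommRing A] [CommRing B] [Algebra A B] [IsLocalRing B]

/-- **No `A`-derivations `B → κ(B)` ⇒ `A → B` formally unramified**, for `B` local and essentially of finite type over `A`: `Ω[B⁄A]` is a
finite `B`-module (Mathlib `KaehlerDifferential.finite`) whose `B`-linear maps to `κ = κ(B)` are the `A`-derivations `B → κ` (Mathlib
`KaehlerDifferential.linearMapEquivDerivation`), all zero; so every `κ`-linear form on `κ ⊗_B Ω[B⁄A]` vanishes, `κ ⊗_B Ω[B⁄A] = 0`, and
`Ω[B⁄A] = 0` by Nakayama (Mathlib `IsLocalRing.subsingleton_tensorProduct`). [cite: StacksProject, Tag 00UO and Tag 00DV]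
[cite: GortzWedhorn2020, (6.4) Prop. 6.7] -/
theorem Algebra.FormallyUnramified.of_forall_derivation_eq_zero [Algebra.EssFiniteType A B] [Algebra A (ResidueField B)]
    [IsScalarTower A B (ResidueField B)] (h : ∀ D : Derivation A B (ResidueField B), D = 0) :
    Algebra.FormallyUnramified A B := by
  -- every `B`-linear map `Ω[B⁄A] → κ` vanishes
  have hlin : ∀ g : Ω[B⁄A] →ₗ[B] ResidueField B, g = 0 := fun g => by
    have hg := h (KaehlerDifferential.linearMapEquivDerivation A B g)
    refine (KaehlerDifferential.linearMapEquivDerivation A B).injective ?_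
    rw [hg, LinearEquiv.map_zero]
  -- hence every `κ`-linear form on `κ ⊗_B Ω[B⁄A]` vanishes, so `κ ⊗_B Ω[B⁄A] = 0`
  have hsub : Subsingleton (ResidueField B ⊗[B] Ω[B⁄A]) := by
    refine subsingleton_of_forall_eq 0 fun v => ?_
    refine (Module.forall_dual_apply_eq_zero_iff (ResidueField B) v).mp fun φ => ?_
    have hφ1 : (φ.restrictScalars B) ∘ₗ (TensorProduct.mk B (ResidueField B) Ω[B⁄A] 1) = 0 := hlin _
    have h1 : ∀ m : Ω[B⁄A], φ ((1 : ResidueField B) ⊗ₜ[B] m) = 0 := fun m => by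
      simpa only [LinearMap.comp_apply, LinearMap.restrictScalars_apply, TensorProduct.mk_apply, LinearMap.zero_apply] using
        LinearMap.congr_fun hφ1 m
    induction v using TensorProduct.induction_on with
    | zero => exact map_zero φ
    | tmul c m =>
      have hcm : c ⊗ₜ[B] m = c • ((1 : ResidueField B) ⊗ₜ[B] m) := by
        rw [TensorProduct.smul_tmul', smul_eq_mul, mul_one]
      rw [hcm, map_smul, h1, smul_zero]
    | add v w hv hw => rw [map_add, hv, hw, add_zero]
  -- Nakayama
  haveI : Subsingleton Ω[B⁄A] := (IsLocalRing.subsingleton_tensorProduct (R := B)).mp hsub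
  exact ⟨inferInstance⟩

end Algebra

/-! ### §3 The `κ[ε]`-point of a derivation -/

section DualNumber

open TrivSqZeroExt DualNumber

/-- The structure map `K → K[ε]` is a local homomorphism (a dual number is a unit iff its constant part is), for any field `K` (★
`isLocalHom_algebraMap_dualNumber` is the case `K = ℂ`). [cite: GortzWedhorn2020, (6.4)] -/
theorem isLocalHom_algebraMap_dualNumber' (K : Type u) [Field K] : IsLocalHom (algebraMap K K[ε]) :=
  ⟨fun c hc => by rwa [isUnit_iff_isUnit_fst, algebraMap_eq_inl, fst_inl] at hc⟩

variable {A B : Type u} [CommRing A] [CommRing B] [Algebra A B] [IsLocalRing B]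

/-- **The `κ[ε]`-point of a derivation.**  For an `A`-derivation `D : B → κ = κ(B)` (`B` local), `b ↦ b̄ + (D b)·ε` is a LOCAL ring
homomorphism `g : B → κ[ε]` with constant part the residue map, `ε`-part `D`, and `g ∘ (A → B) = (κ → κ[ε]) ∘ (residue ∘ (A → B))`
(`D` kills `A`). [cite: GortzWedhorn2020, (6.4) Prop. 6.7] -/
theorem exists_ringHom_dualNumber_of_derivation [Algebra A (ResidueField B)] [IsScalarTower A B (ResidueField B)]
    (D : Derivation A B (ResidueField B)) :
    ∃ g : B →+* (ResidueField B)[ε], IsLocalHom g ∧ (∀ b, fst (g b) = residue B b) ∧ (∀ b, snd (g b) = D b) ∧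
      g.comp (algebraMap A B) = (algebraMap (ResidueField B) (ResidueField B)[ε]).comp ((residue B).comp (algebraMap A B)) := by
  have hsmul : ∀ (b : B) (m : ResidueField B), b • m = residue B b * m := fun b m => Algebra.smul_def b m
  let g : B →+* (ResidueField B)[ε] :=
    { toFun := fun b => inl (residue B b) + inr (D b)
      map_one' := by
        rw [map_one, D.map_one_eq_zero, inr_zero, add_zero]; rfl
      map_mul' := fun b₁ b₂ => by
        refine TrivSqZeroExt.ext ?_ ?_
        · simp only [fst_add, fst_inl, fst_inr, add_zero, fst_mul, map_mul]
        · simp only [snd_add, snd_inl, snd_inr, zero_add, DualNumber.snd_mul, fst_add, fst_inl, fst_inr, add_zero,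
            D.leibniz, hsmul]
          ring
      map_zero' := by rw [map_zero, map_zero, inl_zero, inr_zero, add_zero]
      map_add' := fun b₁ b₂ => by
        rw [map_add, map_add, inl_add, inr_add]; abel }
  have hfst : ∀ b, fst (g b) = residue B b := fun b => by
    change fst (inl (residue B b) + inr (D b)) = _
    rw [fst_add, fst_inl, fst_inr, add_zero]
  have hsnd : ∀ b, snd (g b) = D b := fun b => by
    change snd (inl (residue B b) + inr (D b)) = _
    rw [snd_add, snd_inl, snd_inr, zero_add]
  refine ⟨g, ⟨fun b hb => ?_⟩, hfst, hsnd, ?_⟩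
  · rw [isUnit_iff_isUnit_fst, hfst] at hb
    exact isUnit_of_map_unit (residue B) b hb
  · refine RingHom.ext fun a => TrivSqZeroExt.ext ?_ ?_
    · rw [RingHom.comp_apply, hfst, RingHom.comp_apply, RingHom.comp_apply, algebraMap_eq_inl, fst_inl]
    · rw [RingHom.comp_apply, hsnd, RingHom.comp_apply, RingHom.comp_apply, algebraMap_eq_inl, snd_inl,
        D.map_algebraMap]

end DualNumber

/-! ### §4 The scheme statement -/

section Scheme

open TrivSqZeroExt DualNumber

/-- **NO NON-CONSTANT `K[ε]`-POINTS IN THE FIBRES ⇒ FORMALLY UNRAMIFIED (all points, any base).**  Let `p : X ⟶ Y` be locally of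
finite type and suppose that for every field `K`, every `K[ε]`-point `γ : Spec K[ε] → X` whose image in `Y` is constant
(`γ ≫ p = Spec(K[ε] ← K) ≫ t` for a `K`-point `t` of `Y`) is itself constant (`γ = Spec(K[ε] ← K) ≫ γ₀`).  Then `p` is formally
unramified.  See the module docstring for the proof (derivations `𝒪_{X,x} → κ(x)` over `𝒪_{Y,p x}` as `κ(x)[ε]`-points through `x`, §2,
§1); the hypothesis is used only with `K = κ(x)`, `x ∈ X`. [cite: GortzWedhorn2020, (6.4) Prop. 6.7] [cite: EGAIV4, Prop. 17.4.1 and Cor. 17.4.2]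
[cite: StacksProject, Tag 00UO] -/
theorem FormallyUnramified.of_dualNumber_rigid {X Y : Scheme.{u}} (p : X ⟶ Y) [LocallyOfFiniteType p]
    (h : ∀ (K : Type u) [Field K] (γ : Spec (.of K[ε]) ⟶ X) (t : Spec (.of K) ⟶ Y),
      γ ≫ p = Spec.map (CommRingCat.ofHom (algebraMap K K[ε])) ≫ t →
        ∃ γ₀ : Spec (.of K) ⟶ X, γ = Spec.map (CommRingCat.ofHom (algebraMap K K[ε])) ≫ γ₀) :
    FormallyUnramified p := by
  refine FormallyUnramified.of_forall_stalkMap p fun x => ?_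
  -- the local algebra `A := 𝒪_{Y,p x} → B := 𝒪_{X,x}`, essentially of finite type, and `κ := κ(x)`
  algebraize [(p.stalkMap x).hom]
  have hess : Algebra.EssFiniteType (Y.presheaf.stalk (p.base x)) (X.presheaf.stalk x) := by
    rw [← RingHom.essFiniteType_algebraMap, RingHom.algebraMap_toAlgebra]
    exact LocallyOfFiniteType.stalkMap p x
  letI : Algebra (Y.presheaf.stalk (p.base x)) (ResidueField (X.presheaf.stalk x)) :=
    ((residue (X.presheaf.stalk x)).comp (p.stalkMap x).hom).toAlgebra
  haveI : IsScalarTower (Y.presheaf.stalk (p.base x)) (X.presheaf.stalk x) (ResidueField (X.presheaf.stalk x)) :=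
    IsScalarTower.of_algebraMap_eq fun a => rfl
  rw [← RingHom.algebraMap_toAlgebra (p.stalkMap x).hom, RingHom.formallyUnramified_algebraMap]
  refine Algebra.FormallyUnramified.of_forall_derivation_eq_zero fun D => ?_
  -- the `κ(x)[ε]`-point of `X` through `x` defined by `D`
  obtain ⟨g, hgloc, hfst, hsnd, hcomp⟩ := exists_ringHom_dualNumber_of_derivation D
  set gR : X.presheaf.stalk x ⟶ CommRingCat.of (ResidueField (X.presheaf.stalk x))[ε] := CommRingCat.ofHom g with hgRdef
  haveI : IsLocalHom gR.hom := hgloc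
  haveI : IsLocalHom (CommRingCat.ofHom (algebraMap (ResidueField (X.presheaf.stalk x))
    (ResidueField (X.presheaf.stalk x))[ε])).hom := isLocalHom_algebraMap_dualNumber' _
  -- ring level: `φ ≫ g = φ ≫ residue ≫ (κ → κ[ε])` (`D` kills `A`)
  have hring : p.stalkMap x ≫ gR = p.stalkMap x ≫ X.residue x ≫
      CommRingCat.ofHom (algebraMap (ResidueField (X.presheaf.stalk x)) (ResidueField (X.presheaf.stalk x))[ε]) := by
    apply CommRingCat.hom_ext
    refine RingHom.ext fun a => ?_
    change g ((p.stalkMap x).hom a) = algebraMap (ResidueField (X.presheaf.stalk x)) (ResidueField (X.presheaf.stalk x))[ε]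
      (residue (X.presheaf.stalk x) ((p.stalkMap x).hom a))
    exact RingHom.congr_fun hcomp a
  -- the `κ(x)[ε]`-point `γ := Spec κ[ε] → Spec 𝒪_{X,x} → X` lies over the CONSTANT point `Spec κ[ε] → Spec κ(x) → X → Y`
  have hγp : (Spec.map gR ≫ X.fromSpecStalk x) ≫ p =
      Spec.map (CommRingCat.ofHom (algebraMap (ResidueField (X.presheaf.stalk x)) (ResidueField (X.presheaf.stalk x))[ε])) ≫
        (X.fromSpecResidueField x ≫ p) := by
    change (Spec.map gR ≫ X.fromSpecStalk x) ≫ p =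
      Spec.map (CommRingCat.ofHom (algebraMap (ResidueField (X.presheaf.stalk x)) (ResidueField (X.presheaf.stalk x))[ε])) ≫
        ((Spec.map (X.residue x) ≫ X.fromSpecStalk x) ≫ p)
    simp only [Category.assoc]
    rw [← Scheme.SpecMap_stalkMap_fromSpecStalk, ← Spec.map_comp_assoc, ← Spec.map_comp_assoc, ← Spec.map_comp_assoc, hring]
    rfl
  -- hence `γ` is constant
  obtain ⟨γ₀, hγ₀⟩ := h _ (Spec.map gR ≫ X.fromSpecStalk x) (X.fromSpecResidueField x ≫ p) hγp
  have hx1 : (Spec.map gR ≫ X.fromSpecStalk x).base (closedPoint _) = x := specPtAt_closedPoint gR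
  have hx0 : γ₀.base (closedPoint (ResidueField (X.presheaf.stalk x))) = x := by
    have hx1' := hx1
    rw [hγ₀, Scheme.Hom.comp_apply, Spec_closedPoint] at hx1'
    exact hx1'
  -- so `g` factors through `κ → κ[ε]` (★ §1 dictionary) and its `ε`-part `D` vanishes
  have key : gR = ((X.presheaf.stalkCongr (.of_eq hx0)).inv ≫ Scheme.stalkClosedPointTo γ₀) ≫
      CommRingCat.ofHom (algebraMap (ResidueField (X.presheaf.stalk x)) (ResidueField (X.presheaf.stalk x))[ε]) := by
    rw [← locHomAt_specPtAt gR hx1, locHomAt_congr hγ₀ hx1 (hγ₀ ▸ hx1), locHomAt_SpecMap_comp _ _ hx0 (hγ₀ ▸ hx1)]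
  refine Derivation.ext fun b => ?_
  have hb : g b = algebraMap (ResidueField (X.presheaf.stalk x)) (ResidueField (X.presheaf.stalk x))[ε]
      ((((X.presheaf.stalkCongr (.of_eq hx0)).inv ≫ Scheme.stalkClosedPointTo γ₀)).hom b) := by
    have hk := congrArg (fun φ : X.presheaf.stalk x ⟶ _ => φ.hom b) key
    simp only [hgRdef, CommRingCat.hom_comp, RingHom.comp_apply] at hk
    exact hk
  rw [Derivation.zero_apply, ← hsnd b, hb, algebraMap_eq_inl, snd_inl]

end Scheme

end Literature.AlgebraicGeometry.Morphisms

end
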